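import Summits.BirchSwinnertonDyer.BirchSwinnertonDyer.Theorems.RamifiedSevenEllipticUnitsGeneratorShapeOfPinned
import HarnessLib

set_option linter.dupNamespace false -- `Summit.BirchSwinnertonDyer.BirchSwinnertonDyer.Theorems.…` (summit = sub)
set_option autoImplicit false

/-!
# BED route, «Deuring-ψ lane»: the GENERATOR SHAPE of an `L`-pinned `(1,0)` character at EVERY unramified prime
# (Silverman ATAEC II Prop. 10.4 / Thm. 9.1 (i) as a theorem of the pinning, with no exceptional set)

Route `BiquadraticEisensteinDescent` of `Summits/BirchSwinnertonDyer` (crux `EisensteinHeartFlatCMInertBadKPrime`,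
stmt-BirchSwinnertonDyer-21341): the Deuring print row of `stub_V2`. Cell `bsd-wall`, width seat `bsd-wall-cm-bed-w1` g16.
THEOREMS ONLY (no definition, no named fact, no `sorry`); helper `--supports` 21341.

WHAT. Cell `bsd-cm`'s FILE A `RamifiedSevenEllipticUnitsGeneratorShapeOfPinned` (seat k7r-c2 g16) proves, for `K` imaginary
quadratic with `𝓞_K` principal and ANY Hecke character `ψ` of infinity type `(1, 0)` pinned to a Weierstrass curve `V/ℚ`
(`L(ψ, s) = L(V, s)` on a right half-plane), the generator shape `ψ(ϖ_w) = σ(β_w)`, `(β_w) = 𝔭_w` OFF AN UNCONTROLLED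
FINITE SET of places (`GeneratorShape.shape_of_pinned`: the exceptional set comes from an arbitrary module of
definition in Neukirch's (6.13), `Rigidity.exists_finset_pow_rel`). The displayed print forms
`Deuring_exists_heckeCharacter_of_maximalCM_withGenerators` (clause (vi)) / `…_withUnitValues` (clause (vii)) need the
shape at EVERY unramified place. THIS FILE removes the exceptional set:

* §1 `pow_eq_pow_of_isUnramifiedAt` — Neukirch (6.13) at EVERY `ψ`-unramified principal place: with ONE `M ≥ 1`,
  `ψ(ϖ_w)^M = σ(α)^M` whenever `ψ` is unramified at `w` and `𝔭_w = (α)`. The module of definition is taken supported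
  EXACTLY on the ramified places (tree: `HeckeCharacter.exists_isModulus_of_ramified`), and the relation is the tree's
  `IsModulus.exists_pos_forall_pow_coe_apply_infiniteIdeles_mul_valueAtUniformizer_eq_one` with
  `ψ((α)_∞) = σ(α)⁻¹` (`Rigidity.coe_apply_infiniteIdeles_eq_of_hasInfinityType_one_zero`).
* §2 ★ `exists_generator_of_pinned_of_forall_isUnramifiedAt` — the generator shape at EVERY place `w` over a rational
  prime `ℓ` unramified in `K` above which `ψ` is unramified: k7r-c2's descent (`GeneratorShape.exists_generator_of_split`
  at a split `ℓ = w₁w₂`: `x + x' = a_ℓ`, `xx' = a_ℓ² − a_{ℓ²}`; `…_of_mem` at an inert `ℓ`: `x = a_{ℓ²}`; pinning read by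
  `TwistTransport.coeff_of_pinned_split/_inert`) rerun with §1 in place of the cofinite relation.

For the Grössencharacter of a CM curve every unramified `w` lies over a GOOD prime `ℓ ∤ d_K` with both places over `ℓ`
unramified (`…DeuringOfCore.deuring_of_core_at`), so §2 is exactly clause (vi); the sequel files
`…DeuringUnitValuesOfShape` / `…DeuringWithGeneratorsOfCore` derive (vii) and assemble both print forms from the nine
COREs of the lane. HONEST STATUS: a kernel theorem about Hecke characters; nothing here discharges a named fact by itself;
BSD is not proved for any curve; 21341 / 19225 stay conditional.

References: [SilvermanATAEC1994] II Thm. 9.1 (i), Prop. 10.4, Cor. 10.4.1 (a), Thm. 10.5 (b); [NeukirchANT1999] VII §6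
(6.11)–(6.14), §8 (8.1); cell texts `pub/bsd-wall/STATUS.md` 2026-08-29T04:28Z (this seat's CLAIM).
-/

noncomputable section

open scoped Classical
open Filter NumberField IsDedekindDomain WeierstrassCurve
  Literature.NumberTheory.GaloisRepresentations
  Literature.NumberTheory.GaloisRepresentations.HeckeCharacter
  Literature.NumberTheory.EllipticCurves
  Literature.NumberTheory.EllipticCurves.ModularForms
  Summit.BirchSwinnertonDyer.BirchSwinnertonDyer.Theorems.RamifiedSevenEllipticUnits
  Summit.BirchSwinnertonDyer.BirchSwinnertonDyer.Theorems.RamifiedSevenEllipticUnits.GeneratorShape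

namespace Summit.BirchSwinnertonDyer.BirchSwinnertonDyer.Theorems.BiquadraticEisensteinDescentDeuringOfCore

namespace GeneratorShapeAll

variable {K : Type} [Field K] [NumberField K]

/-! ## §1 Neukirch (6.13) at EVERY unramified principal place -/

/-- **`ψ(ϖ_w)^M = σ(α)^M` at EVERY `ψ`-unramified principal place `𝔭_w = (α)`**, for `ψ` of infinity type `(1, 0)` on an
imaginary quadratic field (`σ = w₀.embedding`), with ONE exponent `M ≥ 1` (`= #(𝒪_K/𝔪)ˣ` for a module of definition `𝔪`
supported exactly on the ramified places of `ψ`). Sharpens `GeneratorShape.exists_finset_pow_eq_pow` (exceptional finset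
uncontrolled) to the exact ramification set. [cite: NeukirchANT1999, Ch. VII §6 Prop. (6.13) (proof) and Cor. (6.14)] -/
theorem pow_eq_pow_of_isUnramifiedAt (hK : IsImaginaryQuadratic K) (w₀ : InfinitePlace K)
    {ψ : HeckeCharacter K} (hinf : ψ.HasInfinityType (fun _ ↦ 1) (fun _ ↦ 0)) :
    ∃ M : ℕ, 0 < M ∧ ∀ {w : HeightOneSpectrum (𝓞 K)}, ψ.IsUnramifiedAt w → ∀ {α : 𝓞 K}, (α : K) ≠ 0 →
      w.asIdeal = Ideal.span {α} → ψ.valueAtUniformizer w ^ M = (w₀.embedding (α : K)) ^ M := by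
  obtain ⟨e, hmod⟩ := ψ.exists_isModulus_of_ramified
  obtain ⟨M, hM, hrel⟩ := hmod.exists_pos_forall_pow_coe_apply_infiniteIdeles_mul_valueAtUniformizer_eq_one
  refine ⟨M, hM, fun {w} hw {α} hα hspan ↦ ?_⟩
  have hwT : w ∉ (finite_ramifiedPlaces_holds ψ).toFinset := fun h ↦
    ((finite_ramifiedPlaces_holds ψ).mem_toFinset.mp h) hw
  have h := hrel hwT hα hspan.symm
  rw [Rigidity.coe_apply_infiniteIdeles_eq_of_hasInfinityType_one_zero hK w₀ hinf, Units.val_mk0, mul_pow,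
    inv_pow] at h
  have hz : (w₀.embedding (α : K)) ^ M ≠ 0 := pow_ne_zero _ ((map_ne_zero _).mpr hα)
  rwa [inv_mul_eq_one₀ hz, eq_comm] at h

/-! ## §2 The generator shape at every place over an unramified rational prime -/

/-- ★ **GENERATOR SHAPE FROM THE PINNING, AT EVERY UNRAMIFIED PRIME.** Let `K` be imaginary quadratic with `𝓞_K` principal,
`ψ` a Hecke character of `K` of infinity type `(1, 0)` with `L(ψ, s) = L(V, s)` (`re s > s₀`) for some Weierstrass curve `V/ℚ`,
and `ℓ` (the place `v` of `ℚ`) a rational prime UNRAMIFIED in `K` above which `ψ` is unramified at every place. Then for every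
place `w ∣ ℓ` of `K`: `ψ(ϖ_w) = σ(β)` for a generator `β` of `𝔭_w` (`σ = w₀.embedding`). Split `ℓ = w₁ w₂`: the pinning gives
`x + x' = a_ℓ ∈ ℤ`, `x x' = a_ℓ² − a_{ℓ²} ∈ ℤ` for `x = ψ(ϖ_{w₁})`, `x' = ψ(ϖ_{w₂})` and §1 gives `x^M = σ(α₁)^M`,
`x'^M = σ(α₂)^M`, whence the quadratic descent `GeneratorShape.exists_generator_of_split`; inert: `ψ(ϖ_w) = a_{ℓ²} ∈ ℤ ⊂ σ(K)`
and `GeneratorShape.exists_generator_of_mem`. This is Silverman ATAEC II Prop. 10.4 («`ψ_{E/L}(𝔓) = α_{E/L}(x) ∈ R_K`»,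
`(α) = N𝔓`) as a THEOREM OF THE PINNING with no exceptional set. [cite: SilvermanATAEC1994, Ch. II Prop. 10.4 and Cor. 10.4.1 (a) (the statement; shape only)]
[cite: NeukirchANT1999, Ch. VII §6 Prop. (6.13), §8 (8.1)] [cite: Ribet1977Nebentypus, §3 Thm. (3.4)] -/
theorem exists_generator_of_pinned_of_forall_isUnramifiedAt (hK : IsImaginaryQuadratic K) [IsPrincipalIdealRing (𝓞 K)]
    (w₀ : InfinitePlace K) {ψ : HeckeCharacter K} (hinf : ψ.HasInfinityType (fun _ ↦ 1) (fun _ ↦ 0))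
    (V : WeierstrassCurve ℚ) (s₀ : ℝ) (hpin : ∀ s : ℂ, s₀ < s.re → heckeLFunction ψ s = V.LSeries s)
    (v : HeightOneSpectrum (𝓞 ℚ)) (he : v.asIdeal.ramificationIdxIn (𝓞 K) = 1)
    (hur : ∀ w' : HeightOneSpectrum (𝓞 K), w'.asIdeal.under (𝓞 ℚ) = v.asIdeal → ψ.IsUnramifiedAt w')
    {w : HeightOneSpectrum (𝓞 K)} (hwv : w.asIdeal.under (𝓞 ℚ) = v.asIdeal) :
    ∃ β : 𝓞 K, Ideal.span {β} = w.asIdeal ∧ ψ.valueAtUniformizer w = w₀.embedding (β : K) := by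
  have h2 : Module.finrank ℚ K = 2 := hK.1
  set σ : K →+* ℂ := w₀.embedding with hσ
  obtain ⟨M, hM, hrel⟩ := pow_eq_pow_of_isUnramifiedAt hK w₀ hinf
  set ℓ : ℕ := Rat.HeightOneSpectrum.natGenerator v with hℓ
  -- generators of principal places and their non-vanishing
  have hgen : ∀ w' : HeightOneSpectrum (𝓞 K), ∃ α : 𝓞 K, (α : K) ≠ 0 ∧ w'.asIdeal = Ideal.span {α} := by
    intro w'
    obtain ⟨α, hα⟩ := Submodule.IsPrincipal.principal w'.asIdeal
    rw [Ideal.submodule_span_eq] at hα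
    refine ⟨α, fun h0 ↦ w'.ne_bot ?_, hα⟩
    rw [hα, Ideal.span_singleton_eq_bot]
    exact_mod_cast h0
  rcases exists_places_eq_pair_or_eq_singleton h2 v he with
    ⟨w₁, w₂, hne, hS, h₁, h₂⟩ | ⟨w₁, hS, hw₁⟩
  · -- SPLIT: `ℓ = w₁ w₂`
    have hm₁ : w₁.asIdeal.under (𝓞 ℚ) = v.asIdeal := by
      have : w₁ ∈ {w' : HeightOneSpectrum (𝓞 K) | w'.asIdeal.under (𝓞 ℚ) = v.asIdeal} := by
        rw [hS]; exact Set.mem_insert _ _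
      exact this
    have hm₂ : w₂.asIdeal.under (𝓞 ℚ) = v.asIdeal := by
      have : w₂ ∈ {w' : HeightOneSpectrum (𝓞 K) | w'.asIdeal.under (𝓞 ℚ) = v.asIdeal} := by
        rw [hS]; exact Set.mem_insert_of_mem _ rfl
      exact this
    have hu₁ : ψ.IsUnramifiedAt w₁ := hur w₁ hm₁
    have hu₂ : ψ.IsUnramifiedAt w₂ := hur w₂ hm₂
    obtain ⟨α₁, hα₁0, hα₁⟩ := hgen w₁
    obtain ⟨α₂, hα₂0, hα₂⟩ := hgen w₂
    have hne₁₂ : Ideal.span {α₁} ≠ Ideal.span {α₂} := fun h ↦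
      hne (HeightOneSpectrum.ext (by rw [hα₁, hα₂, h]))
    have r₁ := hrel hu₁ hα₁0 hα₁
    have r₂ := hrel hu₂ hα₂0 hα₂
    -- the pinning read at the split prime
    obtain ⟨hsum, hsq⟩ := TwistTransport.coeff_of_pinned_split ψ V s₀ hpin v hne hS h₁ h₂ hu₁ hu₂
    set x := ψ.valueAtUniformizer w₁ with hx
    set x' := ψ.valueAtUniformizer w₂ with hx'
    set A : ℤ := V.LFunction ℓ with hA
    set P : ℤ := A ^ 2 - V.LFunction (ℓ ^ 2) with hP
    have hxa : x + x' = σ ((A : ℤ) : K) := by rw [map_intCast, hA, hℓ, hsum]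
    have hxP : x * x' = σ ((P : ℤ) : K) := by
      rw [map_intCast, hP, hA, hℓ]; push_cast; rw [hsum, hsq]; ring
    have hq : x ^ 2 = σ ((A : ℤ) : K) * x - σ ((P : ℤ) : K) := by rw [← hxa, ← hxP]; ring
    have hq' : x' ^ 2 = σ ((A : ℤ) : K) * x' - σ ((P : ℤ) : K) := by rw [← hxa, ← hxP]; ring
    -- `w` is `w₁` or `w₂`
    have hwS : w ∈ {w' : HeightOneSpectrum (𝓞 K) | w'.asIdeal.under (𝓞 ℚ) = v.asIdeal} := hwv
    rw [hS] at hwS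
    rcases hwS with rfl | rfl
    · obtain ⟨β, hspan, hxβ⟩ := exists_generator_of_split σ hα₁0 hne₁₂ hM r₁ r₂ hq hq'
      exact ⟨β, by rw [hspan, hα₁], hxβ⟩
    · obtain ⟨β, hspan, hxβ⟩ := exists_generator_of_split σ hα₂0 hne₁₂.symm hM r₂ r₁ hq' hq
      exact ⟨β, by rw [hspan, hα₂], hxβ⟩
  · -- INERT: `w = w₁`, `ψ(ϖ_w) = a_{ℓ²} ∈ ℤ`
    have hwS : w ∈ {w' : HeightOneSpectrum (𝓞 K) | w'.asIdeal.under (𝓞 ℚ) = v.asIdeal} := hwv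
    rw [hS, Set.mem_singleton_iff] at hwS
    subst hwS
    have hu : ψ.IsUnramifiedAt w := hur w hwv
    obtain ⟨α, hα0, hα⟩ := hgen w
    have r := hrel hu hα0 hα
    have hval := TwistTransport.coeff_of_pinned_inert ψ V s₀ hpin v hS hw₁ hu
    have hxb : ψ.valueAtUniformizer w = σ (((V.LFunction (ℓ ^ 2) : ℤ)) : K) := by
      rw [map_intCast, hℓ, hval]
    obtain ⟨β, hspan, hxβ⟩ := exists_generator_of_mem σ hα0 hM r hxb
    exact ⟨β, by rw [hspan, hα], hxβ⟩

/-- **The same, packaged over the rational prime**: under the hypotheses of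
`exists_generator_of_pinned_of_forall_isUnramifiedAt`, EVERY place of `K` over `ℓ` is `ψ`-unramified with the generator shape.
[cite: SilvermanATAEC1994, Ch. II Prop. 10.4 and Cor. 10.4.1 (a) (the statement; shape only)] -/
theorem forall_shape_of_pinned_of_forall_isUnramifiedAt (hK : IsImaginaryQuadratic K) [IsPrincipalIdealRing (𝓞 K)]
    (w₀ : InfinitePlace K) {ψ : HeckeCharacter K} (hinf : ψ.HasInfinityType (fun _ ↦ 1) (fun _ ↦ 0))
    (V : WeierstrassCurve ℚ) (s₀ : ℝ) (hpin : ∀ s : ℂ, s₀ < s.re → heckeLFunction ψ s = V.LSeries s)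
    (v : HeightOneSpectrum (𝓞 ℚ)) (he : v.asIdeal.ramificationIdxIn (𝓞 K) = 1)
    (hur : ∀ w' : HeightOneSpectrum (𝓞 K), w'.asIdeal.under (𝓞 ℚ) = v.asIdeal → ψ.IsUnramifiedAt w') :
    ∀ w : HeightOneSpectrum (𝓞 K), w.asIdeal.under (𝓞 ℚ) = v.asIdeal →
      ψ.IsUnramifiedAt w ∧ ∃ β : 𝓞 K, Ideal.span {β} = w.asIdeal ∧ ψ.valueAtUniformizer w = w₀.embedding (β : K) :=
  fun w hw ↦ ⟨hur w hw, exists_generator_of_pinned_of_forall_isUnramifiedAt hK w₀ hinf V s₀ hpin v he hur hw⟩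

end GeneratorShapeAll

end Summit.BirchSwinnertonDyer.BirchSwinnertonDyer.Theorems.BiquadraticEisensteinDescentDeuringOfCore

end
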